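import Summits.AtomisticToContinuum.HydrodynamicLimit.Theorems.InformationPercolationEngineKineticClosureDensity
import Literature.MathematicalPhysics.KineticTheory.EvenStatTruncationBound
import Literature.Analysis.FluidPDE.HardSphereCollisionRecord
import HarnessLib

/-!
# Weak readout at the instant `t` (crux `ChaosClosesEuler`, stmt-AtomisticToContinuum-15141, line `Sketch`,
# stub `stub_readout`) — helper 2: the windowed collision functional and the Enskog rate functional

WHAT. Deterministic bookkeeping for the collision side of the weak readout.

* `window_quad_le_count_add_tail` — the windowed quadratic collision functional over `(t, t+Δ]` is dominated by
  `(1 + L⁺)` times the route's cut-off collision COUNT `K[w]` over `[0, τ]` (any weight `w ≥ 0` that equals `1` on the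
  window: the time bump times the in-band density cut-off, once the density cap makes every collision in band) plus
  the route's quadratic TAIL functional `K[(1 + |vᵢ|² + |vⱼ|²) 1{|vᵢ|² + |vⱼ|² > L}]` (the input `CollisionMomentUI`).
* `integral_B1_le` — the `x`-integral of the Enskog rate functional
  `B¹_r(x) = ∫∫ b_r(y,x) b_r(y',x) π‖v − w‖ dμdμ` of ONE configuration is at most `2π R · n⁻¹Σᵢ‖vᵢ‖` whenever
  the `r`-mollified density is capped by `R` (r-INDEPENDENT: `‖v − w‖ ≤ ‖v‖ + ‖w‖`, one cone factor is the capped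
  density, the other integrates to one).
* `abs_setIntegral_integral_bump_le` — hence the space–time Enskog functional tested against a time bump of
  width `3Δ` and an in-band cut-off `g` with `|g·Y| ≤ C` is at most `3Δ · C · C_B`.
* the time bump and the density cut-off (explicit continuous piecewise-linear functions) with their elementary
  properties; the registered sub-goal `stub_readoutWindow` is the termwise split of the quadratic mark.

REFERENCES. P. Résibois, M. De Leener, *Classical Kinetic Theory of Fluids* (1977), Ch. VII (Enskog collision
frequency `∝ Y(n) n`); the estimates themselves are elementary. No named fact is invoked.
-/

noncomputable section

namespace Summit.AtomisticToContinuum.HydrodynamicLimit.Theorems.ChaosClosesEulerReadout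

open scoped BigOperators Topology Classical MeasureTheory ENNReal InnerProductSpace
open Filter Set MeasureTheory
open Literature.MathematicalPhysics.KineticTheory
open Literature.Analysis.FluidPDE
open Literature.Analysis.FunctionSpaces
open Summit.AtomisticToContinuum.HydrodynamicLimit.Theorems.DensityCapNegative
  (cone mollDensity cone_nonneg cone_le mollDensity_eq mollDensity_nonneg)
open Summit.AtomisticToContinuum.HydrodynamicLimit.Theorems.KineticClosureDensity
  (continuous_cone_right integral_cone_eq_one')

/-! ## §1 The windowed quadratic functional against the cut-off count and the quadratic tail -/

/-- **Registered sub-goal `stub_readoutWindow` (helper 2 of `stub_readout`): termwise split of the quadratic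
mark.** `1 + a + b ≤ (1 + L⁺)·1 + (1 + a + b)·1{a + b > L}`. [folklore] -/
theorem stub_readoutWindow : ∀ L a b : ℝ, 1 + a + b ≤ (1 + max L 0) + (if L < a + b then 1 + a + b else 0) := by
  intro L a b
  split_ifs with h
  · linarith [le_max_right L 0]
  · linarith [le_max_left L 0, not_lt.1 h]

/-- Exchanging a symmetric double sum: `Σᵢ Σⱼ cᵢ cⱼ π (aᵢ + aⱼ) = 2π (Σ c) (Σ c a)`. [folklore] -/
theorem sum_sum_mul_mul_add {ι : Type*} (s : Finset ι) (c a : ι → ℝ) (p : ℝ) :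
    ∑ i ∈ s, ∑ j ∈ s, c i * c j * (p * (a i + a j)) = 2 * p * (∑ i ∈ s, c i) * ∑ i ∈ s, c i * a i := by
  have h1 : ∑ i ∈ s, ∑ j ∈ s, c i * c j * (p * (a i + a j)) =
      p * (∑ i ∈ s, ∑ j ∈ s, (c i * a i) * c j) + p * (∑ i ∈ s, ∑ j ∈ s, c i * (c j * a j)) := by
    rw [Finset.mul_sum, Finset.mul_sum, ← Finset.sum_add_distrib]
    refine Finset.sum_congr rfl fun i _ => ?_
    rw [Finset.mul_sum, Finset.mul_sum, ← Finset.sum_add_distrib]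
    exact Finset.sum_congr rfl fun j _ => by ring
  rw [h1, ← Finset.sum_mul_sum, ← Finset.sum_mul_sum]
  ring

/-- **The windowed quadratic collision functional is dominated by the cut-off count plus the quadratic tail.**
Along a curve `γ` with finitely many collision times in `[0, τ]`, for a window `(t, t + Δ] ⊆ [0, τ]`, a level `L`
and a weight `w u i ≥ 0` equal to `1` on the window:
`Σ_{coll ∈ (t,t+Δ]} Σ_{contact} (1 + ‖vᵢ‖² + ‖vⱼ‖²) ≤ (1 + L⁺) Σ_{coll ∈ [0,τ]} Σ_{contact} w
  + Σ_{coll ∈ [0,τ]} Σ_{contact} (1 + ‖vᵢ‖² + ‖vⱼ‖²) 1{‖vᵢ‖² + ‖vⱼ‖² > L}` (all sums in the inline form of the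
route statements). [folklore] -/
theorem window_quad_le_count_add_tail {n : ℕ} {ε : ℝ} {γ : ℝ → Config n (Fin 3) T3} {t Δ τ : ℝ}
    (hfin : (collisionTimes (Torus.geometry (Fin 3)) ε γ ∩ Set.Icc 0 τ).Finite)
    (ht : 0 ≤ t) (hτ : t + Δ ≤ τ) (L : ℝ) (w : ℝ → Fin n → ℝ) (hw0 : ∀ u i, 0 ≤ w u i)
    (hw1 : ∀ u ∈ Set.Ioc t (t + Δ), ∀ i, w u i = 1) :
    (∑ᶠ u ∈ collisionTimes (Torus.geometry (Fin 3)) ε γ ∩ Set.Ioc t (t + Δ),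
      ∑ i, ∑ j, if i ≠ j ∧ ‖(Torus.geometry (Fin 3)).sepVec (γ u i).1 (γ u j).1‖ = ε then
        1 + ‖(γ u i).2‖ ^ 2 + ‖(γ u j).2‖ ^ 2 else 0) ≤
    (1 + max L 0) * (∑ᶠ u ∈ collisionTimes (Torus.geometry (Fin 3)) ε γ ∩ Set.Icc 0 τ,
      ∑ i, ∑ j, if i ≠ j ∧ ‖(Torus.geometry (Fin 3)).sepVec (γ u i).1 (γ u j).1‖ = ε then w u i else 0) +
    ∑ᶠ u ∈ collisionTimes (Torus.geometry (Fin 3)) ε γ ∩ Set.Icc 0 τ,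
      ∑ i, ∑ j, if i ≠ j ∧ ‖(Torus.geometry (Fin 3)).sepVec (γ u i).1 (γ u j).1‖ = ε then
        (if L < ‖(γ u i).2‖ ^ 2 + ‖(γ u j).2‖ ^ 2 then 1 + ‖(γ u i).2‖ ^ 2 + ‖(γ u j).2‖ ^ 2 else 0) else 0 := by
  have hsub : collisionTimes (Torus.geometry (Fin 3)) ε γ ∩ Set.Ioc t (t + Δ) ⊆
      collisionTimes (Torus.geometry (Fin 3)) ε γ ∩ Set.Icc 0 τ :=
    Set.inter_subset_inter_right _ fun u hu => ⟨ht.trans hu.1.le, hu.2.trans hτ⟩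
  have hfinW := hfin.subset hsub
  have hL : 0 ≤ 1 + max L 0 := by positivity
  rw [finsum_mem_eq_finite_toFinset_sum _ hfinW, finsum_mem_eq_finite_toFinset_sum _ hfin,
    finsum_mem_eq_finite_toFinset_sum _ hfin]
  -- termwise on the window
  have hterm : ∀ u ∈ hfinW.toFinset,
      (∑ i, ∑ j, if i ≠ j ∧ ‖(Torus.geometry (Fin 3)).sepVec (γ u i).1 (γ u j).1‖ = ε then
        1 + ‖(γ u i).2‖ ^ 2 + ‖(γ u j).2‖ ^ 2 else 0) ≤
      (1 + max L 0) * (∑ i, ∑ j, if i ≠ j ∧ ‖(Torus.geometry (Fin 3)).sepVec (γ u i).1 (γ u j).1‖ = ε then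
        w u i else 0) +
      ∑ i, ∑ j, if i ≠ j ∧ ‖(Torus.geometry (Fin 3)).sepVec (γ u i).1 (γ u j).1‖ = ε then
        (if L < ‖(γ u i).2‖ ^ 2 + ‖(γ u j).2‖ ^ 2 then 1 + ‖(γ u i).2‖ ^ 2 + ‖(γ u j).2‖ ^ 2 else 0)
        else 0 := by
    intro u hu
    have huW : u ∈ Set.Ioc t (t + Δ) := (hfinW.mem_toFinset.1 hu).2
    rw [Finset.mul_sum, ← Finset.sum_add_distrib]
    refine Finset.sum_le_sum fun i _ => ?_
    rw [Finset.mul_sum, ← Finset.sum_add_distrib]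
    refine Finset.sum_le_sum fun j _ => ?_
    by_cases hc : (i ≠ j ∧ ‖(Torus.geometry (Fin 3)).sepVec (γ u i).1 (γ u j).1‖ = ε)
    · simp only [if_pos hc]
      rw [hw1 u huW i, mul_one]
      exact stub_readoutWindow L _ _
    · simp only [if_neg hc, mul_zero, add_zero, le_refl]
  -- nonnegativity of the two dominating families
  have hA0 : ∀ u ∈ hfin.toFinset, 0 ≤ ∑ i, ∑ j,
      if i ≠ j ∧ ‖(Torus.geometry (Fin 3)).sepVec (γ u i).1 (γ u j).1‖ = ε then w u i else 0 :=
    fun u _ => Finset.sum_nonneg fun i _ => Finset.sum_nonneg fun j _ => by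
      split_ifs
      · exact hw0 u i
      · exact le_rfl
  have hB0 : ∀ u ∈ hfin.toFinset, 0 ≤ ∑ i, ∑ j,
      if i ≠ j ∧ ‖(Torus.geometry (Fin 3)).sepVec (γ u i).1 (γ u j).1‖ = ε then
        (if L < ‖(γ u i).2‖ ^ 2 + ‖(γ u j).2‖ ^ 2 then 1 + ‖(γ u i).2‖ ^ 2 + ‖(γ u j).2‖ ^ 2 else 0) else 0 :=
    fun u _ => Finset.sum_nonneg fun i _ => Finset.sum_nonneg fun j _ => by
      split_ifs
      · positivity
      · exact le_rfl
      · exact le_rfl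
  have hsubF : hfinW.toFinset ⊆ hfin.toFinset := Set.Finite.toFinset_subset_toFinset.2 hsub
  calc _ ≤ ∑ u ∈ hfinW.toFinset, ((1 + max L 0) * (∑ i, ∑ j,
          if i ≠ j ∧ ‖(Torus.geometry (Fin 3)).sepVec (γ u i).1 (γ u j).1‖ = ε then w u i else 0) +
        ∑ i, ∑ j, if i ≠ j ∧ ‖(Torus.geometry (Fin 3)).sepVec (γ u i).1 (γ u j).1‖ = ε then
          (if L < ‖(γ u i).2‖ ^ 2 + ‖(γ u j).2‖ ^ 2 then 1 + ‖(γ u i).2‖ ^ 2 + ‖(γ u j).2‖ ^ 2 else 0)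
          else 0) := Finset.sum_le_sum hterm
    _ = (1 + max L 0) * ∑ u ∈ hfinW.toFinset, (∑ i, ∑ j,
          if i ≠ j ∧ ‖(Torus.geometry (Fin 3)).sepVec (γ u i).1 (γ u j).1‖ = ε then w u i else 0) +
        ∑ u ∈ hfinW.toFinset, ∑ i, ∑ j,
          if i ≠ j ∧ ‖(Torus.geometry (Fin 3)).sepVec (γ u i).1 (γ u j).1‖ = ε then
            (if L < ‖(γ u i).2‖ ^ 2 + ‖(γ u j).2‖ ^ 2 then 1 + ‖(γ u i).2‖ ^ 2 + ‖(γ u j).2‖ ^ 2 else 0)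
            else 0 := by rw [Finset.sum_add_distrib, Finset.mul_sum]
    _ ≤ _ := add_le_add (mul_le_mul_of_nonneg_left (Finset.sum_le_sum_of_subset_of_nonneg hsubF
          fun u hu _ => hA0 u hu) hL) (Finset.sum_le_sum_of_subset_of_nonneg hsubF fun u hu _ => hB0 u hu)

/-! ## §2 The Enskog rate functional of one configuration -/

/-- **The Enskog rate functional integrates to at most `2π R · n⁻¹Σ‖vᵢ‖` under a density cap `R`.** For a
configuration `w` of `N + 1` particles and `0 < r ≤ 1/2`, if the `r`-mollified empirical density is everywhere at
most `R`, then `∫ₓ B¹_r(w)(x) dx ≤ 2π R · (N+1)⁻¹ Σᵢ ‖vᵢ‖`, where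
`B¹_r(w)(x) = ∫∫ b_r(y,x) b_r(y',x) π‖v − v'‖ d(μ_w ⊗ μ_w)` (`‖v − v'‖ ≤ ‖v‖ + ‖v'‖`, one cone factor sums to the
capped mollified density, the other integrates to one over the centre). [folklore] -/
theorem integral_B1_le {N : ℕ} (w : Config (N + 1) (Fin 3) T3) {r : ℝ} (hr : 0 < r) (hr2 : r ≤ 1 / 2) {R : ℝ}
    (hR : ∀ y, DensityCapNegative.mollDensity r w y ≤ R) :
    ∫ x, (∫ p, cone r p.1.1 x * cone r p.2.1 x * (Real.pi * ‖p.1.2 - p.2.2‖)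
        ∂((empiricalMeasure w).prod (empiricalMeasure w))) ≤
      2 * Real.pi * R * (((N + 1 : ℕ) : ℝ)⁻¹ * ∑ i, ‖(w i).2‖) := by
  set n : ℝ := ((N + 1 : ℕ) : ℝ) with hn
  have hn0 : 0 < n := by rw [hn]; positivity
  have hR0 : 0 ≤ R := (mollDensity_nonneg hr w 0).trans (hR 0)
  -- the momentum-weighted cone average `m x = n⁻¹ Σᵢ b_r(xᵢ, x) ‖vᵢ‖`
  have hm0 : ∀ x, 0 ≤ n⁻¹ * ∑ i, cone r (w i).1 x * ‖(w i).2‖ := fun x =>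
    mul_nonneg (inv_nonneg.2 hn0.le) (Finset.sum_nonneg fun i _ => mul_nonneg (cone_nonneg hr _ _) (norm_nonneg _))
  have hmc : Continuous fun x : T3 => n⁻¹ * ∑ i, cone r (w i).1 x * ‖(w i).2‖ :=
    continuous_const.mul (continuous_finsetSum _ fun i _ => (continuous_cone_right r (w i).1).mul continuous_const)
  have hmi : Integrable (fun x : T3 => n⁻¹ * ∑ i, cone r (w i).1 x * ‖(w i).2‖) volume :=
    integrable_of_continuous_T3 hmc
  -- pointwise bound of the rate functional
  have hpt : ∀ x, ∫ p, cone r p.1.1 x * cone r p.2.1 x * (Real.pi * ‖p.1.2 - p.2.2‖)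
      ∂((empiricalMeasure w).prod (empiricalMeasure w)) ≤
      2 * Real.pi * R * (n⁻¹ * ∑ i, cone r (w i).1 x * ‖(w i).2‖) := by
    intro x
    rw [integral_prod_empiricalMeasure_eq_sum]
    have hρ : n⁻¹ * ∑ i, cone r (w i).1 x ≤ R := by
      have h := hR x
      rwa [mollDensity_eq] at h
    calc n⁻¹ * n⁻¹ * ∑ i, ∑ j, cone r (w i).1 x * cone r (w j).1 x * (Real.pi * ‖(w i).2 - (w j).2‖)
        ≤ n⁻¹ * n⁻¹ * ∑ i, ∑ j, cone r (w i).1 x * cone r (w j).1 x * (Real.pi * (‖(w i).2‖ + ‖(w j).2‖)) := by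
          gcongr with i _ j _
          · exact mul_nonneg (cone_nonneg hr _ _) (cone_nonneg hr _ _)
          · exact norm_sub_le _ _
      _ = 2 * Real.pi * (n⁻¹ * ∑ i, cone r (w i).1 x) * (n⁻¹ * ∑ i, cone r (w i).1 x * ‖(w i).2‖) := by
          rw [sum_sum_mul_mul_add]
          ring
      _ ≤ 2 * Real.pi * R * (n⁻¹ * ∑ i, cone r (w i).1 x * ‖(w i).2‖) := by gcongr; exact hm0 x
  -- integrate
  have hmint : ∫ x, n⁻¹ * ∑ i, cone r (w i).1 x * ‖(w i).2‖ = n⁻¹ * ∑ i, ‖(w i).2‖ := by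
    rw [integral_const_mul, integral_finsetSum _ fun i _ =>
      (integrable_of_continuous_T3 (continuous_cone_right r (w i).1)).mul_const _]
    congr 1
    refine Finset.sum_congr rfl fun i _ => ?_
    rw [integral_mul_const, integral_cone_eq_one' hr hr2, one_mul]
  calc _ ≤ ∫ x, 2 * Real.pi * R * (n⁻¹ * ∑ i, cone r (w i).1 x * ‖(w i).2‖) := by
        refine integral_mono_of_nonneg (ae_of_all _ fun x => ?_) (hmi.const_mul _) (ae_of_all _ hpt)
        exact integral_nonneg fun p => mul_nonneg (mul_nonneg (cone_nonneg hr _ _) (cone_nonneg hr _ _))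
          (by positivity)
    _ = 2 * Real.pi * R * (n⁻¹ * ∑ i, ‖(w i).2‖) := by rw [integral_const_mul, hmint]

/-- The Enskog rate functional of one configuration is a finite double sum, hence continuous in the centre.
[folklore] -/
theorem continuous_B1 {N : ℕ} (w : Config (N + 1) (Fin 3) T3) (r : ℝ) :
    Continuous fun x : T3 => ∫ p, cone r p.1.1 x * cone r p.2.1 x * (Real.pi * ‖p.1.2 - p.2.2‖)
      ∂((empiricalMeasure w).prod (empiricalMeasure w)) := by
  have h : (fun x : T3 => ∫ p, cone r p.1.1 x * cone r p.2.1 x * (Real.pi * ‖p.1.2 - p.2.2‖)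
      ∂((empiricalMeasure w).prod (empiricalMeasure w))) = fun x =>
      ((N + 1 : ℕ) : ℝ)⁻¹ * ((N + 1 : ℕ) : ℝ)⁻¹ *
        ∑ i, ∑ j, cone r (w i).1 x * cone r (w j).1 x * (Real.pi * ‖(w i).2 - (w j).2‖) :=
    funext fun x => integral_prod_empiricalMeasure_eq_sum w _
  rw [h]
  exact continuous_const.mul (continuous_finsetSum _ fun i _ => continuous_finsetSum _ fun j _ =>
    ((continuous_cone_right r (w i).1).mul (continuous_cone_right r (w j).1)).mul continuous_const)

/-- The Enskog rate functional is nonnegative (`r > 0`). [folklore] -/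
theorem B1_nonneg {N : ℕ} (w : Config (N + 1) (Fin 3) T3) {r : ℝ} (hr : 0 < r) (x : T3) :
    0 ≤ ∫ p, cone r p.1.1 x * cone r p.2.1 x * (Real.pi * ‖p.1.2 - p.2.2‖)
      ∂((empiricalMeasure w).prod (empiricalMeasure w)) :=
  integral_nonneg fun p => mul_nonneg (mul_nonneg (cone_nonneg hr _ _) (cone_nonneg hr _ _)) (by positivity)

/-! ## §3 The space–time Enskog functional against a time bump -/

/-- **The cut-off Enskog functional against a time bump of width `3Δ`.** If `0 ≤ bump ≤ 1` is continuous and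
vanishes off `[t − Δ, t + 2Δ]`, the cut-off `g·Y` is bounded by `C` on `[0, ∞)`, the argument `a ≥ 0`, and
`B ≥ 0` is continuous in `x` with `∫ₓ B(s, ·) ≤ C_B` for `s ∈ [0, τ]`, then
`|∫_{[0,τ]} ∫ₓ bump(s) g(a) Y(a) B| ≤ 3Δ · C · C_B`. [folklore] -/
theorem abs_setIntegral_integral_bump_le {τ t Δ : ℝ} {bump : ℝ → ℝ} (hbm : Continuous bump)
    (hb0 : ∀ s, 0 ≤ bump s) (hb1 : ∀ s, bump s ≤ 1) (hΔ : 0 ≤ Δ)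
    (hsupp : ∀ s, s ∉ Set.Icc (t - Δ) (t + 2 * Δ) → bump s = 0)
    {g Y : ℝ → ℝ} {C : ℝ} (hC : 0 ≤ C) (hgY : ∀ a, 0 ≤ a → |g a * Y a| ≤ C)
    {a : ℝ → T3 → ℝ} (ha : ∀ s x, 0 ≤ a s x)
    {B : ℝ → T3 → ℝ} (hB0 : ∀ s x, 0 ≤ B s x) (hBc : ∀ s, Continuous (B s)) {CB : ℝ} (hCB0 : 0 ≤ CB)
    (hCB : ∀ s ∈ Set.Icc 0 τ, ∫ x, B s x ≤ CB) :
    |∫ s in Set.Icc 0 τ, ∫ x, bump s * g (a s x) * Y (a s x) * B s x| ≤ 3 * Δ * C * CB := by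
  -- the inner integrals
  have hinner : ∀ s ∈ Set.Icc 0 τ, ‖∫ x, bump s * g (a s x) * Y (a s x) * B s x‖ ≤ bump s * (C * CB) := by
    intro s hs
    calc ‖∫ x, bump s * g (a s x) * Y (a s x) * B s x‖ ≤ ∫ x, bump s * C * B s x := by
          refine norm_integral_le_of_norm_le (((integrable_of_continuous_T3 (hBc s)).const_mul _))
            (ae_of_all _ fun x => ?_)
          rw [Real.norm_eq_abs, show bump s * g (a s x) * Y (a s x) * B s x =
            bump s * (g (a s x) * Y (a s x)) * B s x by ring, abs_mul, abs_mul, abs_of_nonneg (hb0 s),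
            abs_of_nonneg (hB0 s x)]
          exact mul_le_mul_of_nonneg_right (mul_le_mul_of_nonneg_left (hgY _ (ha s x)) (hb0 s)) (hB0 s x)
      _ = bump s * C * ∫ x, B s x := integral_const_mul _ _
      _ ≤ bump s * C * CB := by gcongr; exacts [mul_nonneg (hb0 s) hC, hCB s hs]
      _ = bump s * (C * CB) := by ring
  -- the outer integral
  have hbi : IntegrableOn (fun s => bump s * (C * CB)) (Set.Icc 0 τ) volume :=
    (hbm.mul continuous_const).integrableOn_Icc
  have h1 : ‖∫ s in Set.Icc 0 τ, ∫ x, bump s * g (a s x) * Y (a s x) * B s x‖ ≤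
      ∫ s in Set.Icc 0 τ, bump s * (C * CB) :=
    norm_integral_le_of_norm_le hbi ((ae_restrict_iff' measurableSet_Icc).2 (ae_of_all _ hinner))
  rw [Real.norm_eq_abs] at h1
  refine h1.trans ?_
  rw [integral_mul_const]
  -- the bump integrates to at most `3Δ`
  have hind : ∀ s, bump s ≤ (Set.Icc (t - Δ) (t + 2 * Δ)).indicator 1 s := by
    intro s
    by_cases hs : s ∈ Set.Icc (t - Δ) (t + 2 * Δ)
    · rw [Set.indicator_of_mem hs]
      exact hb1 s
    · rw [Set.indicator_of_notMem hs, hsupp s hs]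
  have hIi : Integrable ((Set.Icc (t - Δ) (t + 2 * Δ)).indicator (1 : ℝ → ℝ)) volume :=
    (integrable_indicator_iff measurableSet_Icc).2
      (integrableOn_const (by rw [Real.volume_Icc]; exact ENNReal.ofReal_ne_top))
  have hbint : ∫ s in Set.Icc 0 τ, bump s ≤ 3 * Δ :=
    calc ∫ s in Set.Icc 0 τ, bump s ≤ ∫ s in Set.Icc 0 τ, (Set.Icc (t - Δ) (t + 2 * Δ)).indicator 1 s :=
          setIntegral_mono_on hbm.integrableOn_Icc hIi.integrableOn measurableSet_Icc fun s _ => hind s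
      _ ≤ ∫ s, (Set.Icc (t - Δ) (t + 2 * Δ)).indicator 1 s :=
          setIntegral_le_integral hIi (ae_of_all _ fun s => Set.indicator_nonneg (fun _ _ => zero_le_one) s)
      _ = 3 * Δ := by
          rw [integral_indicator_one measurableSet_Icc, measureReal_def, Real.volume_Icc,
            ENNReal.toReal_ofReal (by linarith)]
          ring
  calc (∫ s in Set.Icc 0 τ, bump s) * (C * CB) ≤ (3 * Δ) * (C * CB) :=
        mul_le_mul_of_nonneg_right hbint (mul_nonneg hC hCB0)
    _ = 3 * Δ * C * CB := by ring

/-! ## §4 The time bump and the density cut-off -/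

/-- The piecewise-linear time bump `u ↦ max 0 (min 1 (min ((u − t + Δ)/Δ) ((t + 2Δ − u)/Δ)))` (`1` on `[t, t + Δ]`,
`0` off `[t − Δ, t + 2Δ]`) is continuous. [folklore] -/
theorem continuous_bump (t Δ : ℝ) : Continuous fun u : ℝ => max 0 (min 1 (min ((u - t + Δ) / Δ) ((t + 2 * Δ - u) / Δ))) := by
  fun_prop

/-- The time bump takes values in `[0, 1]`. [folklore] -/
theorem bump_mem (t Δ u : ℝ) : 0 ≤ max 0 (min 1 (min ((u - t + Δ) / Δ) ((t + 2 * Δ - u) / Δ))) ∧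
    max 0 (min 1 (min ((u - t + Δ) / Δ) ((t + 2 * Δ - u) / Δ))) ≤ 1 :=
  ⟨le_max_left _ _, max_le zero_le_one (min_le_left _ _)⟩

/-- The time bump equals `1` on the window `[t, t + Δ]` (`Δ > 0`). [folklore] -/
theorem bump_eq_one {t Δ u : ℝ} (hΔ : 0 < Δ) (hu : u ∈ Set.Icc t (t + Δ)) :
    max 0 (min 1 (min ((u - t + Δ) / Δ) ((t + 2 * Δ - u) / Δ))) = 1 := by
  have h1 : 1 ≤ (u - t + Δ) / Δ := by rw [le_div_iff₀ hΔ]; linarith [hu.1]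
  have h2 : 1 ≤ (t + 2 * Δ - u) / Δ := by rw [le_div_iff₀ hΔ]; linarith [hu.2]
  rw [min_eq_left (le_min h1 h2), max_eq_right zero_le_one]

/-- The time bump vanishes off `[t − Δ, t + 2Δ]` (`Δ > 0`). [folklore] -/
theorem bump_eq_zero {t Δ u : ℝ} (hΔ : 0 < Δ) (hu : u ∉ Set.Icc (t - Δ) (t + 2 * Δ)) :
    max 0 (min 1 (min ((u - t + Δ) / Δ) ((t + 2 * Δ - u) / Δ))) = 0 := by
  refine max_eq_left ((min_le_right _ _).trans ?_)
  rcases not_and_or.1 hu with h | h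
  · refine (min_le_left _ _).trans ?_
    rw [div_le_iff₀ hΔ]
    linarith [not_le.1 h]
  · refine (min_le_right _ _).trans ?_
    rw [div_le_iff₀ hΔ]
    linarith [not_le.1 h]

/-- The piecewise-linear density cut-off `a ↦ max 0 (min 1 ((η₂ − a)/(η₂ − η₁)))` (`1` below `η₁`, `0` above `η₂`)
is continuous. [folklore] -/
theorem continuous_cut (η₁ η₂ : ℝ) : Continuous fun a : ℝ => max 0 (min 1 ((η₂ - a) / (η₂ - η₁))) := by
  fun_prop

/-- The density cut-off takes values in `[0, 1]`. [folklore] -/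
theorem cut_mem (η₁ η₂ a : ℝ) : 0 ≤ max 0 (min 1 ((η₂ - a) / (η₂ - η₁))) ∧ max 0 (min 1 ((η₂ - a) / (η₂ - η₁))) ≤ 1 :=
  ⟨le_max_left _ _, max_le zero_le_one (min_le_left _ _)⟩

/-- The density cut-off equals `1` below `η₁` (`η₁ < η₂`). [folklore] -/
theorem cut_eq_one {η₁ η₂ a : ℝ} (h12 : η₁ < η₂) (ha : a ≤ η₁) : max 0 (min 1 ((η₂ - a) / (η₂ - η₁))) = 1 := by
  have h1 : 1 ≤ (η₂ - a) / (η₂ - η₁) := by rw [le_div_iff₀ (sub_pos.2 h12)]; linarith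
  rw [min_eq_left h1, max_eq_right zero_le_one]

/-- The density cut-off vanishes above `η₂` (`η₁ < η₂`). [folklore] -/
theorem cut_eq_zero {η₁ η₂ a : ℝ} (h12 : η₁ < η₂) (ha : η₂ ≤ a) : max 0 (min 1 ((η₂ - a) / (η₂ - η₁))) = 0 := by
  refine max_eq_left ((min_le_right _ _).trans ?_)
  rw [div_le_iff₀ (sub_pos.2 h12)]
  linarith

end Summit.AtomisticToContinuum.HydrodynamicLimit.Theorems.ChaosClosesEulerReadout

end
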